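import Summits.QuantumFields.BalabanUV.T4Continuum.Support.VariationalVectorOneStep

/-!
# T⁴ programme, spine node NE2 (U1a), lane P2 — SUPPLIER LEAF V-ONE FOR E-VALUED 1-FORMS («V-ONE-1F»), file 4: THE ONE-STEP BOUND FOR THE CURL
# FORM OF THE TILTED COMPETITOR IN LATTICE UNITS — main term constant EXACTLY `L^d∕L²`, Hessian error, frame ∕ commutator defects

NE2 formalisation swarm `b2b-balaban-t4-ne2-formalise-*`, leaf prover 01 GEN 6 (`prover-b2b-balaban-t4-ne2-formalise-leaf-01-g6-0`); file 4 of the V-ONE-1F line, the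
Minkowski assembly of file 2's pointwise curl bound `norm_curlV_interpV_le` with file 3's block sums `sum_main_sq_le` ∕ `sum_KV` and the sizes
`sum_norm_sq_PhiFV_le` ∕ `norm_commErr_le`.

THE STATEMENT (**`curlSq_interpV_le`**, lattice units; coarse torus `Tor N`, fine `Tor (fine L N)`; `U′` unitary site frames, `Rc` unitary coarse bond
operators with plaquette defect `‖Rc(y,μ)Rc(y+e_μ,ν) − Rc(y,ν)Rc(y+e_ν,μ)‖ ≤ p`, fine bond operators `R′` with the two FRAME defects `≤ m` of the 0-form files):
    `curlSq (fine L N) R′ (interpV U′ Rc W) ≤ ( √( L^d∕L²·curlSq N Rc W + 8(d+26)·(L^d∕L)·hessV Rc W ) + √( d·L^d·(50·p²∕L + (32(1+d²)+400)·m²)·nsqV N W ) )²`.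
MAIN TERM CONSTANT EXACTLY `L^d∕L²` (after the physical prefactors `(nL)^{2−d}` vs `n^{2−d}`: exactly 1); the Hessian term is `O(L^d∕L)` = one power of `L`
down = `ε₁ ∝ L∕n²` in physical units; the defect term is `O(n·(m + p∕√L))` there.  File 5 rescales and reads `blockSpin`.

HONEST FRAMING (T4-DAG p. 1).  Model level (frames ∕ transports DATA); [folklore] real bookkeeping; nothing printed is a hypothesis; no `def`, no `def … : Prop`,
no `sorry`; axioms standard.  The CURL form only — the gauge functional's one-step consistency is leaf V-GF's.  NE2 NOT proved; spine PROVED 0∕9; rung (B)+1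
finite T⁴ — NOT infinite volume, NOT mass gap, NOT Clay.  HONEST DEPENDENCY (cell, verbatim): continuum YM on T⁴ ⇐ BetaPertH ∧ nine spine estimates (0/9
proved); BetaPertH ⇐ (D1) ∧ (D4) ∧ CAP+tail; G-an2-4 gates asym, D1 and NE2/3/4.
-/

noncomputable section

namespace Summit.QuantumFields.BalabanUV.T4Continuum.VariationalVectorOneStep

open Finset
open Literature.MathematicalPhysics.QuantumFieldTheory.Balaban1983to89
open Literature.MathematicalPhysics.QuantumFieldTheory.Balaban1983to89.B5Prop11Plancherel (Tor fine unitVec)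
open Literature.MathematicalPhysics.QuantumFieldTheory.Balaban1983to89.B5Block118 (bpt)
open Literature.MathematicalPhysics.QuantumFieldTheory.Balaban1983to89.B5AverageCurlStokes (sum_blocks_real)
open Summit.QuantumFields.BalabanUV.T4Continuum.VariationalCovariantFederbush (sum_sq_add_le)
open Summit.QuantumFields.BalabanUV.T4Continuum.VariationalCovariantOneStep (pow_pred_eq)
open Summit.QuantumFields.BalabanUV.T4Continuum.VariationalColourFederbush (cDv norm_le_one_of_mem_unitary)
open Summit.QuantumFields.BalabanUV.T4Continuum.VectorBlockTrialForm (nsqV nsqV_nonneg)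
open Summit.QuantumFields.BalabanUV.T4Continuum.VariationalVectorForm (curlV curlSq curlSq_nonneg)
open Summit.QuantumFields.BalabanUV.T4Continuum.VariationalVectorInterpolant (PhiFV interpV)

variable {d : ℕ} {E : Type*} [NormedAddCommGroup E] [InnerProductSpace ℂ E] [CompleteSpace E]
variable (L : ℕ) [NeZero L] (N : Fin d → ℕ) [∀ μ, NeZero (N μ)] {Rc : Tor N → Fin d → (E →L[ℂ] E)} (W : Tor N → Fin d → E)
variable {U' : Tor (fine L N) → (E →L[ℂ] E)} {R' : Tor (fine L N) → Fin d → (E →L[ℂ] E)} {m p : ℝ}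

/-- the geometric part summed over everything: `Σ_{y,j,μ,ν} ‖geoV(μ,ν) − geoV(ν,μ)‖² ≤ L^d∕L²·curlSq N Rc W + 8(d+26)·(L^d∕L)·hessV` (unitary `Rc`). [folklore] -/
theorem sum_geo_sq_le (hRc1 : ∀ y μ, Rc y μ ∈ unitary (E →L[ℂ] E)) :
    ∑ y : Tor N, ∑ j : Fin d → Fin L, ∑ μ, ∑ ν, ‖geoV L N Rc W y j μ ν - geoV L N Rc W y j ν μ‖ ^ 2
      ≤ (L : ℝ) ^ d / (L : ℝ) ^ 2 * curlSq N Rc W + 8 * ((d : ℝ) + 26) * ((L : ℝ) ^ d / L) * hessV N Rc W := by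
  have hK0 : ∀ y μ ν, 0 ≤ KV N Rc W y μ ν := fun y μ ν => sum_nonneg fun κ _ => by positivity
  -- reorder to `Σ_μ Σ_ν Σ_y Σ_j`
  have hre : ∑ y : Tor N, ∑ j : Fin d → Fin L, ∑ μ, ∑ ν, ‖geoV L N Rc W y j μ ν - geoV L N Rc W y j ν μ‖ ^ 2
      = ∑ μ : Fin d, ∑ ν : Fin d, ∑ y : Tor N, ∑ j : Fin d → Fin L, ‖((L : ℂ))⁻¹ • curlV N Rc W y μ ν + eV L N Rc W y j μ ν‖ ^ 2 := by
    simp_rw [geoV_sub_geoV]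
    calc ∑ y : Tor N, ∑ j : Fin d → Fin L, ∑ μ : Fin d, ∑ ν : Fin d, ‖((L : ℂ))⁻¹ • curlV N Rc W y μ ν + eV L N Rc W y j μ ν‖ ^ 2
        = ∑ y : Tor N, ∑ μ : Fin d, ∑ ν : Fin d, ∑ j : Fin d → Fin L, ‖((L : ℂ))⁻¹ • curlV N Rc W y μ ν + eV L N Rc W y j μ ν‖ ^ 2 :=
          sum_congr rfl fun y _ => (Finset.sum_comm.trans (sum_congr rfl fun μ _ => Finset.sum_comm))
      _ = ∑ μ : Fin d, ∑ y : Tor N, ∑ ν : Fin d, ∑ j : Fin d → Fin L, ‖((L : ℂ))⁻¹ • curlV N Rc W y μ ν + eV L N Rc W y j μ ν‖ ^ 2 :=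
          Finset.sum_comm
      _ = _ := sum_congr rfl fun μ _ => Finset.sum_comm
  -- per pair
  have hpair : ∀ μ ν : Fin d, ∑ y : Tor N, ∑ j : Fin d → Fin L, ‖((L : ℂ))⁻¹ • curlV N Rc W y μ ν + eV L N Rc W y j μ ν‖ ^ 2
      ≤ (L : ℝ) ^ d / (L : ℝ) ^ 2 * ∑ y, ‖curlV N Rc W y μ ν‖ ^ 2 + (2 * (d : ℝ) + 52) * ((L : ℝ) ^ d / L) * ∑ y, KV N Rc W y μ ν := by
    intro μ ν
    by_cases hμν : μ = ν
    · subst hμν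
      have h0 : ∀ (y : Tor N) (j : Fin d → Fin L), ‖((L : ℂ))⁻¹ • curlV N Rc W y μ μ + eV L N Rc W y j μ μ‖ ^ 2 = 0 := by
        intro y j
        have e1 : curlV N Rc W y μ μ = 0 := sub_self _
        have e2 : eV L N Rc W y j μ μ = 0 := sub_self _
        rw [e1, e2, smul_zero, add_zero, norm_zero]; ring
      simp only [h0, sum_const_zero]
      have := sum_nonneg fun y (_ : y ∈ (univ : Finset (Tor N))) => hK0 y μ μ
      positivity
    · exact sum_main_sq_le L N Rc W hμν (fun y => hRc1 y μ) (fun y => hRc1 y ν)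
  have hcurl : ∑ μ : Fin d, ∑ ν : Fin d, ∑ y : Tor N, ‖curlV N Rc W y μ ν‖ ^ 2 = curlSq N Rc W := by
    unfold curlSq
    calc ∑ μ : Fin d, ∑ ν : Fin d, ∑ y : Tor N, ‖curlV N Rc W y μ ν‖ ^ 2 = ∑ μ : Fin d, ∑ y : Tor N, ∑ ν : Fin d, ‖curlV N Rc W y μ ν‖ ^ 2 :=
          sum_congr rfl fun μ _ => Finset.sum_comm
      _ = _ := Finset.sum_comm
  rw [hre]
  calc _ ≤ ∑ μ : Fin d, ∑ ν : Fin d, ((L : ℝ) ^ d / (L : ℝ) ^ 2 * ∑ y, ‖curlV N Rc W y μ ν‖ ^ 2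
          + (2 * (d : ℝ) + 52) * ((L : ℝ) ^ d / L) * ∑ y, KV N Rc W y μ ν) := sum_le_sum fun μ _ => sum_le_sum fun ν _ => hpair μ ν
    _ = (L : ℝ) ^ d / (L : ℝ) ^ 2 * curlSq N Rc W + (2 * (d : ℝ) + 52) * ((L : ℝ) ^ d / L) * (4 * hessV N Rc W) := by
        simp only [sum_add_distrib, ← mul_sum]
        rw [hcurl, sum_KV]
    _ = _ := by ring

omit [CompleteSpace E] in
/-- the commutator terms summed: `Σ_{y,j,μ,ν} ‖commErr(y,j,μ,ν)‖² ≤ (25∕4)·p²·L^{d−1}·d·nsqV N W`. [folklore] -/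
theorem sum_commErr_sq_le (hp : ∀ y μ ν, ‖plaq N Rc y μ ν‖ ≤ p) :
    ∑ y : Tor N, ∑ j : Fin d → Fin L, ∑ μ, ∑ ν, ‖commErr L N Rc W y j μ ν‖ ^ 2 ≤ 25 / 4 * p ^ 2 * (L : ℝ) ^ (d - 1) * (d * nsqV N W) := by
  have hshift : ∀ μ ν : Fin d, ∑ y : Tor N, ‖W (y + unitVec N μ + unitVec N ν) ν‖ ^ 2 = ∑ y, ‖W y ν‖ ^ 2 := fun μ ν =>
    Fintype.sum_equiv (Equiv.addRight (unitVec N μ + unitVec N ν)) _ _ fun y => by simp only [Equiv.coe_addRight, add_assoc]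
  have hpt : ∀ (y : Tor N) (j : Fin d → Fin L) (μ ν : Fin d), ‖commErr L N Rc W y j μ ν‖ ^ 2
      ≤ (if (j μ : ℕ) + 1 = L then (1 : ℝ) else 0) * (25 / 4 * p ^ 2 * ‖W (y + unitVec N μ + unitVec N ν) ν‖ ^ 2) := by
    intro y j μ ν
    have h := norm_commErr_le L N Rc W hp y j μ ν
    split_ifs at h ⊢ with hj
    · rw [one_mul] at h ⊢
      have h2 := pow_le_pow_left₀ (norm_nonneg _) h 2
      nlinarith [h2]
    · rw [zero_mul] at h ⊢; rw [le_antisymm h (norm_nonneg _)]; norm_num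
  calc _ ≤ ∑ y : Tor N, ∑ j : Fin d → Fin L, ∑ μ, ∑ ν, (if (j μ : ℕ) + 1 = L then (1 : ℝ) else 0) * (25 / 4 * p ^ 2 * ‖W (y + unitVec N μ + unitVec N ν) ν‖ ^ 2) :=
        sum_le_sum fun y _ => sum_le_sum fun j _ => sum_le_sum fun μ _ => sum_le_sum fun ν _ => hpt y j μ ν
    _ = ∑ y : Tor N, ∑ μ, ∑ ν, (L : ℝ) ^ (d - 1) * (25 / 4 * p ^ 2 * ‖W (y + unitVec N μ + unitVec N ν) ν‖ ^ 2) := by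
        refine sum_congr rfl fun y _ => ?_
        rw [Finset.sum_comm]
        refine sum_congr rfl fun μ _ => ?_
        rw [Finset.sum_comm]
        refine sum_congr rfl fun ν _ => ?_
        rw [← sum_mul, VariationalCovariantWeights.sum_ind_last L μ]
    _ = (L : ℝ) ^ (d - 1) * (25 / 4 * p ^ 2) * ∑ μ : Fin d, ∑ ν : Fin d, ∑ y : Tor N, ‖W (y + unitVec N μ + unitVec N ν) ν‖ ^ 2 := by
        rw [Finset.sum_comm]
        simp only [mul_sum]
        refine sum_congr rfl fun μ _ => ?_
        rw [Finset.sum_comm]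
        exact sum_congr rfl fun ν _ => sum_congr rfl fun y _ => by ring
    _ = (L : ℝ) ^ (d - 1) * (25 / 4 * p ^ 2) * (d * nsqV N W) := by
        simp_rw [hshift]
        have e : ∑ ν : Fin d, ∑ y : Tor N, ‖W y ν‖ ^ 2 = nsqV N W := by unfold nsqV; rw [Finset.sum_comm]
        simp only [e, sum_const, card_univ, Fintype.card_fin, nsmul_eq_mul]
    _ = _ := by ring

omit [CompleteSpace E] in
/-- the shifted interpolant sizes summed: `Σ_{y,j,μ,ν} ‖Φ_ν(L·y+j+e_μ)‖² ≤ d·(4(1+d²)+50)·L^d·nsqV N W`. [folklore] -/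
theorem sum_PhiFV_shift_sq_le (hRc : ∀ y μ, ‖Rc y μ‖ ≤ 1) :
    ∑ y : Tor N, ∑ j : Fin d → Fin L, ∑ μ, ∑ ν, ‖PhiFV L N Rc W (bpt L N y j + unitVec (fine L N) μ) ν‖ ^ 2
      ≤ d * ((4 * (1 + (d : ℝ) ^ 2) + 50) * ((L : ℝ) ^ d * nsqV N W)) := by
  have h1 : ∑ y : Tor N, ∑ j : Fin d → Fin L, ∑ μ, ∑ ν, ‖PhiFV L N Rc W (bpt L N y j + unitVec (fine L N) μ) ν‖ ^ 2
      = ∑ μ : Fin d, ∑ ν : Fin d, ∑ x : Tor (fine L N), ‖PhiFV L N Rc W x ν‖ ^ 2 := by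
    rw [← sum_blocks_real L N (fun x => ∑ μ, ∑ ν, ‖PhiFV L N Rc W (x + unitVec (fine L N) μ) ν‖ ^ 2), Finset.sum_comm]
    refine sum_congr rfl fun μ _ => ?_
    rw [Finset.sum_comm]
    refine sum_congr rfl fun ν _ => ?_
    exact Fintype.sum_equiv (Equiv.addRight (unitVec (fine L N) μ)) _ _ fun x => rfl
  rw [h1]
  calc _ ≤ ∑ μ : Fin d, ∑ ν : Fin d, (4 * (1 + (d : ℝ) ^ 2) + 50) * ((L : ℝ) ^ d * ∑ y, ‖W y ν‖ ^ 2) :=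
        sum_le_sum fun μ _ => sum_le_sum fun ν _ => sum_norm_sq_PhiFV_le L N Rc W hRc ν
    _ = d * ((4 * (1 + (d : ℝ) ^ 2) + 50) * ((L : ℝ) ^ d * nsqV N W)) := by
        have e : ∑ ν : Fin d, (4 * (1 + (d : ℝ) ^ 2) + 50) * ((L : ℝ) ^ d * ∑ y : Tor N, ‖W y ν‖ ^ 2)
            = (4 * (1 + (d : ℝ) ^ 2) + 50) * ((L : ℝ) ^ d * nsqV N W) := by
          rw [← mul_sum, ← mul_sum]; unfold nsqV; rw [Finset.sum_comm]
        simp only [e, sum_const, card_univ, Fintype.card_fin, nsmul_eq_mul]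

/-- **LEAF V-ONE-1F, LATTICE END — THE CURL FORM OF THE TILTED COMPETITOR**: unitary site frames `U′`, unitary coarse bond operators `Rc` with plaquette
defect `≤ p`, fine bond operators `R′` with the two frame defects `≤ m`:
`curlSq (fine L N) R′ Λ′ ≤ ( √( L^d∕L²·curlSq N Rc W + 8(d+26)·(L^d∕L)·hessV ) + √( d·L^d·(50p²∕L + (32(1+d²)+400)·m²)·nsqV N W ) )²` —
MAIN TERM CONSTANT EXACTLY `L^d∕L²`. [folklore] -/
theorem curlSq_interpV_le (hU : ∀ x, U' x ∈ unitary (E →L[ℂ] E)) (hRc1 : ∀ y μ, Rc y μ ∈ unitary (E →L[ℂ] E)) (hm : 0 ≤ m)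
    (hin : ∀ (y : Tor N) (j : Fin d → Fin L) (μ : Fin d), (j μ : ℕ) + 1 < L →
      ‖R' (bpt L N y j) μ * star (U' (bpt L N y j + unitVec (fine L N) μ)) - star (U' (bpt L N y j))‖ ≤ m)
    (hcross : ∀ (y : Tor N) (j : Fin d → Fin L) (μ : Fin d), (j μ : ℕ) + 1 = L →
      ‖R' (bpt L N y j) μ * star (U' (bpt L N y j + unitVec (fine L N) μ)) - star (U' (bpt L N y j)) * Rc y μ‖ ≤ m)
    (hp : ∀ y μ ν, ‖plaq N Rc y μ ν‖ ≤ p) :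
    curlSq (fine L N) R' (interpV L N U' Rc W)
      ≤ (Real.sqrt ((L : ℝ) ^ d / (L : ℝ) ^ 2 * curlSq N Rc W + 8 * ((d : ℝ) + 26) * ((L : ℝ) ^ d / L) * hessV N Rc W)
          + Real.sqrt (d * (L : ℝ) ^ d * (50 * p ^ 2 / L + (32 * (1 + (d : ℝ) ^ 2) + 400) * m ^ 2) * nsqV N W)) ^ 2 := by
  have hL1 : 1 ≤ L := Nat.one_le_iff_ne_zero.mpr (NeZero.ne L)
  have hRc : ∀ y μ, ‖Rc y μ‖ ≤ 1 := fun y μ => norm_le_one_of_mem_unitary (hRc1 y μ)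
  rcases isEmpty_or_nonempty (Fin d) with hd | hne
  · -- no directions: the fine curl form is an empty sum
    have h0 : curlSq (fine L N) R' (interpV L N U' Rc W) = 0 := by
      unfold curlSq; exact sum_eq_zero fun x _ => Finset.sum_eq_zero fun μ _ => (hd.false μ).elim
    rw [h0]; positivity
  obtain ⟨μ0⟩ := hne
  obtain ⟨hpow, -⟩ := pow_pred_eq (d := d) L μ0 hL1
  -- the index set `σ = ((y, j), (μ, ν))` and the two budgets
  set I := (Tor N × (Fin d → Fin L)) × (Fin d × Fin d)
  set A : I → ℝ := fun σ => ‖geoV L N Rc W σ.1.1 σ.1.2 σ.2.1 σ.2.2 - geoV L N Rc W σ.1.1 σ.1.2 σ.2.2 σ.2.1‖ with hA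
  set B : I → ℝ := fun σ => ‖commErr L N Rc W σ.1.1 σ.1.2 σ.2.1 σ.2.2‖ + ‖commErr L N Rc W σ.1.1 σ.1.2 σ.2.2 σ.2.1‖
    + m * (‖PhiFV L N Rc W (bpt L N σ.1.1 σ.1.2 + unitVec (fine L N) σ.2.1) σ.2.2‖
      + ‖PhiFV L N Rc W (bpt L N σ.1.1 σ.1.2 + unitVec (fine L N) σ.2.2) σ.2.1‖) with hB
  -- nested ↔ flat sums
  have hflat : ∀ g : Tor N → (Fin d → Fin L) → Fin d → Fin d → ℝ,
      ∑ σ : I, g σ.1.1 σ.1.2 σ.2.1 σ.2.2 = ∑ y, ∑ j, ∑ μ, ∑ ν, g y j μ ν := by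
    intro g
    rw [Fintype.sum_prod_type]
    simp only [Fintype.sum_prod_type]
  -- pointwise
  have hpt : ∀ σ : I, ‖curlV (fine L N) R' (interpV L N U' Rc W) (bpt L N σ.1.1 σ.1.2) σ.2.1 σ.2.2‖ ^ 2 ≤ (A σ + 1 * B σ) ^ 2 := fun σ => by
    rw [one_mul]
    exact pow_le_pow_left₀ (norm_nonneg _) (norm_curlV_interpV_le L N W hU hm hin hcross σ.1.1 σ.1.2 σ.2.1 σ.2.2) 2
  have hsum : curlSq (fine L N) R' (interpV L N U' Rc W) ≤ ∑ σ : I, (A σ + 1 * B σ) ^ 2 := by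
    calc curlSq (fine L N) R' (interpV L N U' Rc W)
        = ∑ σ : I, ‖curlV (fine L N) R' (interpV L N U' Rc W) (bpt L N σ.1.1 σ.1.2) σ.2.1 σ.2.2‖ ^ 2 := by
          unfold curlSq
          rw [sum_blocks_real L N (fun x => ∑ μ, ∑ ν, ‖curlV (fine L N) R' (interpV L N U' Rc W) x μ ν‖ ^ 2),
            hflat (fun y j μ ν => ‖curlV (fine L N) R' (interpV L N U' Rc W) (bpt L N y j) μ ν‖ ^ 2)]
      _ ≤ _ := sum_le_sum fun σ _ => hpt σ
  have hmink := sum_sq_add_le (univ : Finset I) A B zero_le_one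
  -- the geometric budget
  have hA2 : ∑ σ : I, A σ ^ 2 ≤ (L : ℝ) ^ d / (L : ℝ) ^ 2 * curlSq N Rc W + 8 * ((d : ℝ) + 26) * ((L : ℝ) ^ d / L) * hessV N Rc W := by
    rw [hA, hflat (fun y j μ ν => ‖geoV L N Rc W y j μ ν - geoV L N Rc W y j ν μ‖ ^ 2)]
    exact sum_geo_sq_le L N W hRc1
  -- the defect budget
  have hB2 : ∑ σ : I, B σ ^ 2 ≤ d * (L : ℝ) ^ d * (50 * p ^ 2 / L + (32 * (1 + (d : ℝ) ^ 2) + 400) * m ^ 2) * nsqV N W := by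
    have h4 : ∀ σ : I, B σ ^ 2 ≤ 4 * (‖commErr L N Rc W σ.1.1 σ.1.2 σ.2.1 σ.2.2‖ ^ 2 + ‖commErr L N Rc W σ.1.1 σ.1.2 σ.2.2 σ.2.1‖ ^ 2
        + m ^ 2 * ‖PhiFV L N Rc W (bpt L N σ.1.1 σ.1.2 + unitVec (fine L N) σ.2.1) σ.2.2‖ ^ 2
        + m ^ 2 * ‖PhiFV L N Rc W (bpt L N σ.1.1 σ.1.2 + unitVec (fine L N) σ.2.2) σ.2.1‖ ^ 2) := by
      intro σ
      rw [hB]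
      set w := ‖commErr L N Rc W σ.1.1 σ.1.2 σ.2.1 σ.2.2‖
      set x := ‖commErr L N Rc W σ.1.1 σ.1.2 σ.2.2 σ.2.1‖
      set u := ‖PhiFV L N Rc W (bpt L N σ.1.1 σ.1.2 + unitVec (fine L N) σ.2.1) σ.2.2‖
      set v := ‖PhiFV L N Rc W (bpt L N σ.1.1 σ.1.2 + unitVec (fine L N) σ.2.2) σ.2.1‖
      nlinarith [sq_nonneg (w - x), sq_nonneg (w - m * u), sq_nonneg (w - m * v), sq_nonneg (x - m * u), sq_nonneg (x - m * v),
        sq_nonneg (m * u - m * v)]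
    have hc1 := sum_commErr_sq_le L N W hp
    have hc2 : ∑ y : Tor N, ∑ j : Fin d → Fin L, ∑ μ, ∑ ν, ‖commErr L N Rc W y j ν μ‖ ^ 2 ≤ 25 / 4 * p ^ 2 * (L : ℝ) ^ (d - 1) * (d * nsqV N W) := by
      calc _ = ∑ y : Tor N, ∑ j : Fin d → Fin L, ∑ μ, ∑ ν, ‖commErr L N Rc W y j μ ν‖ ^ 2 :=
            sum_congr rfl fun y _ => sum_congr rfl fun j _ => Finset.sum_comm
        _ ≤ _ := hc1
    have hf1 := sum_PhiFV_shift_sq_le L N W hRc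
    have hf2 : ∑ y : Tor N, ∑ j : Fin d → Fin L, ∑ μ, ∑ ν, ‖PhiFV L N Rc W (bpt L N y j + unitVec (fine L N) ν) μ‖ ^ 2
        ≤ d * ((4 * (1 + (d : ℝ) ^ 2) + 50) * ((L : ℝ) ^ d * nsqV N W)) := by
      calc _ = ∑ y : Tor N, ∑ j : Fin d → Fin L, ∑ μ, ∑ ν, ‖PhiFV L N Rc W (bpt L N y j + unitVec (fine L N) μ) ν‖ ^ 2 :=
            sum_congr rfl fun y _ => sum_congr rfl fun j _ => Finset.sum_comm
        _ ≤ _ := hf1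
    have hm2 : 0 ≤ m ^ 2 := sq_nonneg m
    -- flat forms of the four bounds
    have hc1' : ∑ σ : I, ‖commErr L N Rc W σ.1.1 σ.1.2 σ.2.1 σ.2.2‖ ^ 2 ≤ 25 / 4 * p ^ 2 * (L : ℝ) ^ (d - 1) * (d * nsqV N W) := by
      rw [hflat (fun y j μ ν => ‖commErr L N Rc W y j μ ν‖ ^ 2)]; exact hc1
    have hc2' : ∑ σ : I, ‖commErr L N Rc W σ.1.1 σ.1.2 σ.2.2 σ.2.1‖ ^ 2 ≤ 25 / 4 * p ^ 2 * (L : ℝ) ^ (d - 1) * (d * nsqV N W) := by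
      rw [hflat (fun y j μ ν => ‖commErr L N Rc W y j ν μ‖ ^ 2)]; exact hc2
    have hf1' : ∑ σ : I, ‖PhiFV L N Rc W (bpt L N σ.1.1 σ.1.2 + unitVec (fine L N) σ.2.1) σ.2.2‖ ^ 2
        ≤ d * ((4 * (1 + (d : ℝ) ^ 2) + 50) * ((L : ℝ) ^ d * nsqV N W)) := by
      rw [hflat (fun y j μ ν => ‖PhiFV L N Rc W (bpt L N y j + unitVec (fine L N) μ) ν‖ ^ 2)]; exact hf1
    have hf2' : ∑ σ : I, ‖PhiFV L N Rc W (bpt L N σ.1.1 σ.1.2 + unitVec (fine L N) σ.2.2) σ.2.1‖ ^ 2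
        ≤ d * ((4 * (1 + (d : ℝ) ^ 2) + 50) * ((L : ℝ) ^ d * nsqV N W)) := by
      rw [hflat (fun y j μ ν => ‖PhiFV L N Rc W (bpt L N y j + unitVec (fine L N) ν) μ‖ ^ 2)]; exact hf2
    calc ∑ σ : I, B σ ^ 2
        ≤ ∑ σ : I, 4 * (‖commErr L N Rc W σ.1.1 σ.1.2 σ.2.1 σ.2.2‖ ^ 2 + ‖commErr L N Rc W σ.1.1 σ.1.2 σ.2.2 σ.2.1‖ ^ 2
            + m ^ 2 * ‖PhiFV L N Rc W (bpt L N σ.1.1 σ.1.2 + unitVec (fine L N) σ.2.1) σ.2.2‖ ^ 2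
            + m ^ 2 * ‖PhiFV L N Rc W (bpt L N σ.1.1 σ.1.2 + unitVec (fine L N) σ.2.2) σ.2.1‖ ^ 2) := sum_le_sum fun σ _ => h4 σ
      _ = 4 * (∑ σ : I, ‖commErr L N Rc W σ.1.1 σ.1.2 σ.2.1 σ.2.2‖ ^ 2 + ∑ σ : I, ‖commErr L N Rc W σ.1.1 σ.1.2 σ.2.2 σ.2.1‖ ^ 2
            + m ^ 2 * ∑ σ : I, ‖PhiFV L N Rc W (bpt L N σ.1.1 σ.1.2 + unitVec (fine L N) σ.2.1) σ.2.2‖ ^ 2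
            + m ^ 2 * ∑ σ : I, ‖PhiFV L N Rc W (bpt L N σ.1.1 σ.1.2 + unitVec (fine L N) σ.2.2) σ.2.1‖ ^ 2) := by
          rw [← mul_sum]
          simp only [sum_add_distrib, mul_sum]
      _ ≤ 4 * (25 / 4 * p ^ 2 * (L : ℝ) ^ (d - 1) * (d * nsqV N W) + 25 / 4 * p ^ 2 * (L : ℝ) ^ (d - 1) * (d * nsqV N W)
            + m ^ 2 * (d * ((4 * (1 + (d : ℝ) ^ 2) + 50) * ((L : ℝ) ^ d * nsqV N W)))
            + m ^ 2 * (d * ((4 * (1 + (d : ℝ) ^ 2) + 50) * ((L : ℝ) ^ d * nsqV N W)))) :=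
          mul_le_mul_of_nonneg_left (add_le_add (add_le_add (add_le_add hc1' hc2') (mul_le_mul_of_nonneg_left hf1' hm2))
            (mul_le_mul_of_nonneg_left hf2' hm2)) (by norm_num)
      _ = _ := by rw [hpow]; ring
  -- assemble
  have hsA := Real.sqrt_le_sqrt hA2
  have hsB := Real.sqrt_le_sqrt hB2
  have h0 : 0 ≤ Real.sqrt (∑ σ : I, A σ ^ 2) + 1 * Real.sqrt (∑ σ : I, B σ ^ 2) := by positivity
  calc curlSq (fine L N) R' (interpV L N U' Rc W) ≤ _ := hsum
    _ ≤ _ := hmink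
    _ ≤ _ := pow_le_pow_left₀ h0 (add_le_add hsA (by rw [one_mul]; exact hsB)) 2

end Summit.QuantumFields.BalabanUV.T4Continuum.VariationalVectorOneStep

end
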